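import Summits.QuantumFields.BalabanUV.Beta.GAN24.T2OfDiffCovariance

/-!
# `BalabanUV.Beta.GAN24.T2OfBracketCovariance` — binder row G-an2-4 / (CONV-C), W-slot road «W3» (SKELETON-W3 v1.0 §8.3, ROW W3-F2a's
# TABLE; TRIGGER-W (w2)), companion of `GAN24/T2OfValueCovariance` / `GAN24/T2OfDiffCovariance`: the SOURCE BRACKET `b♮_j` of the
# normalised Stage-B recursion (leaf-04's `T2RecursionAffine.unitS₂_T2Of_succ_affine`) is covariant under ALL unit translations on the
# field–field block, so its CELL zero mode (leaf-02's `zmode`) and its POINTWISE zero mode (the `Zfree` of record) are equivalent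

NOT IN PRINT; OUR BOOKKEEPING (G-an2-4 formalisation swarm, leaf prover `b2b-balaban-gan24-formalise-leaf-11`, gen 18; journal INTENT
«W3-FFCOV*» PART 3; plumbing for ROW W3-F2a — NOT the row; module name PROVISIONAL — the row owner gan24-p1 may rename / re-home it).
HONEST FRAMING (cell contract, verbatim): «discharging `BetaPertH` makes Bałaban's UV stability UNCONDITIONAL — a real constructive-QFT
result; it is NOT the continuum limit and NOT the Clay problem.»  HONEST DEPENDENCY (verbatim): «continuum YM on T⁴ ⇐ BetaPertH ∧ nine spine
estimates (0/9 proved); BetaPertH ⇐ (D1) ∧ (D4) ∧ CAP+tail; G-an2-4 gates asym, D1 and NE2/3/4.»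

THE TABLE.  With the level-`j` units `(s_f, s_m) = (sfStep Lc j, smStep d Lc j)` and `K♮_j := unitK s_f s_m (KInvStep Lc j)`,
`S♮_j := unitS s_f s_m (Spure … j)`, `M♮_j := unitM s_f s_m (M1 … j)`, `M₂♮_j := unitM₂ s_f s_m (M2Of mixFF j)`, ROW W3-F2a's table is the
bracket
  `b♮_j := fun κ u κ′ u′ ↦ (cE₂·Lc^(2(d+1))) • mmRead Lc (K3OfK K♮_j Lc S♮_j M♮_j (W2SymOfK K♮_j Lc S♮_j M♮_j 0 M₂♮_j)) κ u κ′ u′ + cB • mfNeg (vh₂S κ u κ′ u′)`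
(the `T♮_j`-free part of the normalised member `j+1`; `T2RecursionAffine.unitS₂_T2Of_succ_affine`, p212454).

WHAT ([folklore] composition BY NAME of an2's `e4OfW_translate` / `W2SymOfK_translate` / `Spure_translate` / `M1_translate` / `M2Of_translate`,
an4's `shiftK_KInvStep` / `unitW_W2SymOfK`, leaf-19's `T2SlotUnits.unitS₂_value_eq` and `T2SlotCovariance.smul_translate` / `unitS₂_translate`,
and the slot-wise bridge of `T2OfValueCovariance`; generic `d`, `1 ≤ Lc`, every `j`, colour constants SYMBOLIC, ANY border `vh₂S` (only its zero
field–field block `hBff` is used — the bracket's value part does not see the border), ANY `mixFF` under `hmixt`):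
* §1 `zeroTab_translate` (the zero bi-table is block-covariant, `rfl`), **`e4OfW_zeroTab_translate`** (the RAW value table
  `e4OfW j (Spure j) (M1 j) (W2SymOfK (KInvStep Lc j) Lc (Spure j) (M1 j) 0 (M2Of mixFF j))` is covariant under ALL unit translations as a
  whole table — NO border hypothesis).
* §2 **`bracketVal_eq_unitS₂`** (the literal normalised value part `= unitS₂ (sfStep Lc (j+1)) (smStep d Lc (j+1)) ((cE₂·wV4 (j+1)) • that table)`),
  **`bracketVal_translate`** (whole table, `shiftK (−t)`), **`bracket_ff_translate`** (the literal `b♮_j`, every field–field slot, under `hBff`).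
* §3 **`zmode_ff_bracket_iff_pointwise`** (`N ≠ 0`): `(∀ κ κ′ α β, zmode N b♮_j κ κ′ (inl α) (inl β) = 0) ↔ (∀ κ u κ′ α β, Σ'_{u′xz} b♮_j … = 0)`.
* §4 instances: `zmode_ff_bracket_iff_pointwise_an1` (an1's tables at ANY roots, no binder left), `zmode_ff_bracket_iff_pointwise_base`
  (the row's literal base-root text `vh₂S d Lc`, generic `mixFF` under `hmixt`).
0 `def`, 0 cite, 0 `def … : Prop`, 0 sorry.  Asserts NO zero-mode VALUE of the bracket (that is ROW W3-F2a, leaf-20's «W3-ZS*»); NOT a row of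
SKELETON-W3 §8.3; discharges NOTHING of «T2Shape» / «T2SupRate» / (hW, hWall); 0/2 W wall binders; NOT «W-slot closed», NEVER «G-an2-4
closed», NOT (CONV-C); NOT BetaPertH, NOT continuum, NOT Clay.
-/

noncomputable section

open Finset
open scoped BigOperators
open Literature.MathematicalPhysics.QuantumFieldTheory
open Literature.MathematicalPhysics.QuantumFieldTheory.Balaban1983to89
open Literature.MathematicalPhysics.QuantumFieldTheory.Balaban1983to89.Beta
open ExpKernelCalculus (MKer shiftK)
open OneStepResolventKernel (Fib)
open OneStepKernelFamily (KInvStep shiftK_KInvStep)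
open StepJetData (mfNeg mfNeg_inl_inl)
open BalabanStepJetsSucc (mmRead)
open SecondOrderResponse (W2SymOfK W2SymOfK_translate)
open BalabanStepW2 (wV4 Spure M1 M2Of K3OfK e4OfW Spure_translate M1_translate M2Of_translate e4OfW_translate)
open AveragingMixedJetTables (vh₂S vh₂SAt mixFFAt mixFFAt_translate)
open Summit.QuantumFields.BalabanUV.Beta.HessKerDressedUnits (unitK unitS)
open Summit.QuantumFields.BalabanUV.Beta.SecondOrderUnits (unitM unitS₂ unitM₂ unitW_W2SymOfK)
open Summit.QuantumFields.BalabanUV.Beta.GAN24.CombesThomas (sfStep smStep sfStep_ne_zero smStep_ne_zero)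
open Summit.QuantumFields.BalabanUV.Beta.GAN24.T2SlotUnits (unitS₂_apply unitS₂_value_eq)
open Summit.QuantumFields.BalabanUV.Beta.GAN24.BiStencilZeroMode (Tab zmode)
open Summit.QuantumFields.BalabanUV.Beta.GAN24.T2SlotCovariance (smul_translate unitS₂_translate)
open Summit.QuantumFields.BalabanUV.Beta.GAN24.T2OfValueCovariance (slot_translate_of_translate slot_translate_add
  zmode_ff_eq_zero_iff_pointwise_of_ff)
open Summit.QuantumFields.BalabanUV.Beta.GAN24.T2OfDiffCovariance (vh₂SAt_inl_inl')

namespace Summit.QuantumFields.BalabanUV.Beta.GAN24.T2OfBracketCovariance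

variable {d : ℕ} {Lc : ℕ} [NeZero Lc]

/-! ## §1 The raw value table of the bracket is covariant under all unit translations (no border hypothesis) -/

section Generic

omit [NeZero Lc] in
/-- [folklore] The ZERO bi-stencil table is jointly block-covariant (both sides are the zero kernel), by `rfl`. -/
theorem zeroTab_translate (κ : Fin (d + 1)) (u : Fin (d + 1) → ℤ) (κ' : Fin (d + 1)) (u' t : Fin (d + 1) → ℤ) :
    (0 : Tab d) κ (u + (Lc : ℤ) • t) κ' (u' + (Lc : ℤ) • t) = shiftK (-((Lc : ℤ) • t)) ((0 : Tab d) κ u κ' u') := rfl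

variable (hLc : 1 ≤ Lc) (cE cVH cΛ : ℝ) {mixFF : Tab d}
  (hmixt : ∀ (κ : Fin (d + 1)) (u : Fin (d + 1) → ℤ) (ρ : Fin (d + 1)) (w t : Fin (d + 1) → ℤ),
    mixFF κ (u + (Lc : ℤ) • t) ρ (w + t) = shiftK (-((Lc : ℤ) • t)) (mixFF κ u ρ w))

include hLc hmixt in
/-- [folklore] **THE RAW VALUE TABLE OF THE BRACKET IS COVARIANT UNDER ALL UNIT TRANSLATIONS OF THE STEP-`(j+1)` LATTICE**: an2's
`e4OfW_translate` at the `T₂ := 0` second-order member `W2SymOfK (KInvStep Lc j) Lc (Spure j) (M1 j) 0 (M2Of mixFF j)` (`W2SymOfK_translate`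
with an4's `shiftK_KInvStep`, `Spure_translate`, `M1_translate`, the zero bi-table, `M2Of_translate hmixt`).  The border never enters. -/
theorem e4OfW_zeroTab_translate (j : ℕ) (κ : Fin (d + 1)) (u : Fin (d + 1) → ℤ) (κ' : Fin (d + 1)) (u' t : Fin (d + 1) → ℤ) :
    e4OfW d Lc j (Spure d Lc cE cVH cΛ j) (M1 d Lc cΛ j)
        (W2SymOfK (KInvStep (d := d) Lc j) Lc (Spure d Lc cE cVH cΛ j) (M1 d Lc cΛ j) 0 (M2Of d Lc mixFF j)) κ (u + t) κ' (u' + t)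
      = shiftK (-t) (e4OfW d Lc j (Spure d Lc cE cVH cΛ j) (M1 d Lc cΛ j)
        (W2SymOfK (KInvStep (d := d) Lc j) Lc (Spure d Lc cE cVH cΛ j) (M1 d Lc cΛ j) 0 (M2Of d Lc mixFF j)) κ u κ' u') :=
  e4OfW_translate j (Spure_translate hLc cE cVH cΛ j) (M1_translate (Lc := Lc) cΛ j)
    (W2SymOfK_translate (N := Lc) (fun s => shiftK_KInvStep (Lc := Lc) (d := d) j s) (Spure_translate hLc cE cVH cΛ j)
      (M1_translate (Lc := Lc) cΛ j) (zeroTab_translate (d := d) (Lc := Lc)) (M2Of_translate (Lc := Lc) hmixt j)) κ u κ' u' t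

/-! ## §2 The normalised value part of the bracket, and the bracket on the field–field block -/

/-- [folklore] **THE LITERAL NORMALISED VALUE PART OF THE BRACKET IS `unitS₂` OF THE WEIGHTED RAW VALUE TABLE** at the step-`(j+1)` units:
leaf-19's `T2SlotUnits.unitS₂_value_eq` ⨾ an4's `unitW_W2SymOfK` ⨾ `unitS₂ s_f s_m 0 = 0`. -/
theorem bracketVal_eq_unitS₂ (cE₂ : ℝ) (mixFF : Tab d) (j : ℕ) :
    (fun κ u κ' u' => (cE₂ * (Lc : ℝ) ^ (2 * (d + 1))) •
        mmRead Lc (K3OfK (unitK (sfStep Lc j) (smStep d Lc j) (KInvStep (d := d) Lc j)) Lc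
          (unitS (sfStep Lc j) (smStep d Lc j) (Spure d Lc cE cVH cΛ j)) (unitM (sfStep Lc j) (smStep d Lc j) (M1 d Lc cΛ j))
          (W2SymOfK (unitK (sfStep Lc j) (smStep d Lc j) (KInvStep (d := d) Lc j)) Lc
            (unitS (sfStep Lc j) (smStep d Lc j) (Spure d Lc cE cVH cΛ j)) (unitM (sfStep Lc j) (smStep d Lc j) (M1 d Lc cΛ j)) 0
            (unitM₂ (sfStep Lc j) (smStep d Lc j) (M2Of d Lc mixFF j))) κ u κ' u'))
      = unitS₂ (sfStep Lc (j + 1)) (smStep d Lc (j + 1)) (fun κ u κ' u' => (cE₂ * wV4 d Lc (j + 1)) •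
          e4OfW d Lc j (Spure d Lc cE cVH cΛ j) (M1 d Lc cΛ j)
            (W2SymOfK (KInvStep (d := d) Lc j) Lc (Spure d Lc cE cVH cΛ j) (M1 d Lc cΛ j) 0 (M2Of d Lc mixFF j)) κ u κ' u') := by
  have hz : unitS₂ (sfStep Lc j) (smStep d Lc j) (0 : Tab d) = 0 := by
    funext κ u κ' u' x z a b
    rw [unitS₂_apply]
    simp
  rw [unitS₂_value_eq, unitW_W2SymOfK (N := Lc) (sfStep_ne_zero j) (smStep_ne_zero j), hz]

include hLc hmixt in
/-- [folklore] **THE NORMALISED VALUE PART OF THE BRACKET IS COVARIANT UNDER ALL UNIT TRANSLATIONS AS A WHOLE TABLE** (`e4OfW_zeroTab_translate`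
carried through leaf-19's `smul_translate` / `unitS₂_translate` at `(w, v) = (t, −t)`, then `bracketVal_eq_unitS₂`). -/
theorem bracketVal_translate (cE₂ : ℝ) (j : ℕ) (κ : Fin (d + 1)) (u : Fin (d + 1) → ℤ) (κ' : Fin (d + 1)) (u' t : Fin (d + 1) → ℤ) :
    (fun κ u κ' u' => (cE₂ * (Lc : ℝ) ^ (2 * (d + 1))) •
        mmRead Lc (K3OfK (unitK (sfStep Lc j) (smStep d Lc j) (KInvStep (d := d) Lc j)) Lc
          (unitS (sfStep Lc j) (smStep d Lc j) (Spure d Lc cE cVH cΛ j)) (unitM (sfStep Lc j) (smStep d Lc j) (M1 d Lc cΛ j))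
          (W2SymOfK (unitK (sfStep Lc j) (smStep d Lc j) (KInvStep (d := d) Lc j)) Lc
            (unitS (sfStep Lc j) (smStep d Lc j) (Spure d Lc cE cVH cΛ j)) (unitM (sfStep Lc j) (smStep d Lc j) (M1 d Lc cΛ j)) 0
            (unitM₂ (sfStep Lc j) (smStep d Lc j) (M2Of d Lc mixFF j))) κ u κ' u')) κ (u + t) κ' (u' + t)
      = shiftK (-t) ((fun κ u κ' u' => (cE₂ * (Lc : ℝ) ^ (2 * (d + 1))) •
        mmRead Lc (K3OfK (unitK (sfStep Lc j) (smStep d Lc j) (KInvStep (d := d) Lc j)) Lc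
          (unitS (sfStep Lc j) (smStep d Lc j) (Spure d Lc cE cVH cΛ j)) (unitM (sfStep Lc j) (smStep d Lc j) (M1 d Lc cΛ j))
          (W2SymOfK (unitK (sfStep Lc j) (smStep d Lc j) (KInvStep (d := d) Lc j)) Lc
            (unitS (sfStep Lc j) (smStep d Lc j) (Spure d Lc cE cVH cΛ j)) (unitM (sfStep Lc j) (smStep d Lc j) (M1 d Lc cΛ j)) 0
            (unitM₂ (sfStep Lc j) (smStep d Lc j) (M2Of d Lc mixFF j))) κ u κ' u')) κ u κ' u') := by
  rw [bracketVal_eq_unitS₂ (Lc := Lc) cE cVH cΛ cE₂ mixFF j]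
  exact unitS₂_translate (w := t) (v := -t) (sfStep Lc (j + 1)) (smStep d Lc (j + 1))
    (smul_translate (w := t) (v := -t) (cE₂ * wV4 d Lc (j + 1))
      (fun κ u κ' u' => e4OfW_zeroTab_translate hLc cE cVH cΛ hmixt j κ u κ' u' t)) κ u κ' u'

variable {vh₂S : Tab d}
  (hBff : ∀ (κ : Fin (d + 1)) (u : Fin (d + 1) → ℤ) (κ' : Fin (d + 1)) (u' x z : Fin (d + 1) → ℤ) (α β : Fin (d + 1)),
    vh₂S κ u κ' u' x z (Sum.inl α) (Sum.inl β) = 0)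

include hBff in
omit [NeZero Lc] in
/-- [folklore] The border summand `cB • (mfNeg ∘ vh₂S)` is zero on the field–field block (`mfNeg_inl_inl`, `hBff`), hence trivially
slot-wise covariant there. -/
theorem border_ff_translate (cB : ℝ) (α β κ : Fin (d + 1)) (u : Fin (d + 1) → ℤ) (κ' : Fin (d + 1))
    (u' t x z : Fin (d + 1) → ℤ) :
    (fun κ u κ' u' => cB • mfNeg (vh₂S κ u κ' u')) κ (u + t) κ' (u' + t) x z (Sum.inl α) (Sum.inl β)
      = (fun κ u κ' u' => cB • mfNeg (vh₂S κ u κ' u')) κ u κ' u' (x + -t) (z + -t) (Sum.inl α) (Sum.inl β) := by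
  simp only [Pi.smul_apply, smul_eq_mul, mfNeg_inl_inl, hBff, mul_zero]

include hLc hmixt hBff in
/-- [folklore] **ROW W3-F2a's TABLE — THE LITERAL BRACKET `b♮_j` — IS COVARIANT UNDER ALL UNIT TRANSLATIONS ON EVERY FIELD–FIELD SLOT.** -/
theorem bracket_ff_translate (cE₂ cB : ℝ) (j : ℕ) (α β κ : Fin (d + 1)) (u : Fin (d + 1) → ℤ) (κ' : Fin (d + 1))
    (u' t x z : Fin (d + 1) → ℤ) :
    (fun κ u κ' u' => (cE₂ * (Lc : ℝ) ^ (2 * (d + 1))) •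
          mmRead Lc (K3OfK (unitK (sfStep Lc j) (smStep d Lc j) (KInvStep (d := d) Lc j)) Lc
            (unitS (sfStep Lc j) (smStep d Lc j) (Spure d Lc cE cVH cΛ j)) (unitM (sfStep Lc j) (smStep d Lc j) (M1 d Lc cΛ j))
            (W2SymOfK (unitK (sfStep Lc j) (smStep d Lc j) (KInvStep (d := d) Lc j)) Lc
              (unitS (sfStep Lc j) (smStep d Lc j) (Spure d Lc cE cVH cΛ j)) (unitM (sfStep Lc j) (smStep d Lc j) (M1 d Lc cΛ j)) 0
              (unitM₂ (sfStep Lc j) (smStep d Lc j) (M2Of d Lc mixFF j))) κ u κ' u')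
        + cB • mfNeg (vh₂S κ u κ' u')) κ (u + t) κ' (u' + t) x z (Sum.inl α) (Sum.inl β)
      = (fun κ u κ' u' => (cE₂ * (Lc : ℝ) ^ (2 * (d + 1))) •
          mmRead Lc (K3OfK (unitK (sfStep Lc j) (smStep d Lc j) (KInvStep (d := d) Lc j)) Lc
            (unitS (sfStep Lc j) (smStep d Lc j) (Spure d Lc cE cVH cΛ j)) (unitM (sfStep Lc j) (smStep d Lc j) (M1 d Lc cΛ j))
            (W2SymOfK (unitK (sfStep Lc j) (smStep d Lc j) (KInvStep (d := d) Lc j)) Lc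
              (unitS (sfStep Lc j) (smStep d Lc j) (Spure d Lc cE cVH cΛ j)) (unitM (sfStep Lc j) (smStep d Lc j) (M1 d Lc cΛ j)) 0
              (unitM₂ (sfStep Lc j) (smStep d Lc j) (M2Of d Lc mixFF j))) κ u κ' u')
        + cB • mfNeg (vh₂S κ u κ' u')) κ u κ' u' (x + -t) (z + -t) (Sum.inl α) (Sum.inl β) :=
  slot_translate_add
    (X := fun κ u κ' u' => (cE₂ * (Lc : ℝ) ^ (2 * (d + 1))) •
          mmRead Lc (K3OfK (unitK (sfStep Lc j) (smStep d Lc j) (KInvStep (d := d) Lc j)) Lc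
            (unitS (sfStep Lc j) (smStep d Lc j) (Spure d Lc cE cVH cΛ j)) (unitM (sfStep Lc j) (smStep d Lc j) (M1 d Lc cΛ j))
            (W2SymOfK (unitK (sfStep Lc j) (smStep d Lc j) (KInvStep (d := d) Lc j)) Lc
              (unitS (sfStep Lc j) (smStep d Lc j) (Spure d Lc cE cVH cΛ j)) (unitM (sfStep Lc j) (smStep d Lc j) (M1 d Lc cΛ j)) 0
              (unitM₂ (sfStep Lc j) (smStep d Lc j) (M2Of d Lc mixFF j))) κ u κ' u'))
    (Y := fun κ u κ' u' => cB • mfNeg (vh₂S κ u κ' u'))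
    (slot_translate_of_translate
      (X := fun κ u κ' u' => (cE₂ * (Lc : ℝ) ^ (2 * (d + 1))) •
          mmRead Lc (K3OfK (unitK (sfStep Lc j) (smStep d Lc j) (KInvStep (d := d) Lc j)) Lc
            (unitS (sfStep Lc j) (smStep d Lc j) (Spure d Lc cE cVH cΛ j)) (unitM (sfStep Lc j) (smStep d Lc j) (M1 d Lc cΛ j))
            (W2SymOfK (unitK (sfStep Lc j) (smStep d Lc j) (KInvStep (d := d) Lc j)) Lc
              (unitS (sfStep Lc j) (smStep d Lc j) (Spure d Lc cE cVH cΛ j)) (unitM (sfStep Lc j) (smStep d Lc j) (M1 d Lc cΛ j)) 0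
              (unitM₂ (sfStep Lc j) (smStep d Lc j) (M2Of d Lc mixFF j))) κ u κ' u'))
      (fun κ u κ' u' t => bracketVal_translate hLc cE cVH cΛ hmixt cE₂ j κ u κ' u' t)
      (Sum.inl α) (Sum.inl β))
    (fun κ u κ' u' t x z => border_ff_translate hBff cB α β κ u κ' u' t x z) κ u κ' u' t x z

/-! ## §3 The cell ⟷ pointwise bridge for ROW W3-F2a's table -/

include hLc hmixt hBff in
/-- [folklore] **CELL ⟷ POINTWISE ff ZERO MODE FOR THE BRACKET `b♮_j`** (`N ≠ 0`): leaf-02's `∀ κ κ′ α β, zmode N b♮_j κ κ′ (inl α) (inl β) = 0`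
is equivalent to the POINTWISE `Zfree b♮_j` of record (TRIGGER-W (w2)) — so ROW W3-F2a may be proved in either currency. -/
theorem zmode_ff_bracket_iff_pointwise {N : ℕ} (hN : N ≠ 0) (cE₂ cB : ℝ) (j : ℕ) :
    (∀ (κ κ' α β : Fin (d + 1)),
        zmode N (fun κ u κ' u' => (cE₂ * (Lc : ℝ) ^ (2 * (d + 1))) •
            mmRead Lc (K3OfK (unitK (sfStep Lc j) (smStep d Lc j) (KInvStep (d := d) Lc j)) Lc
              (unitS (sfStep Lc j) (smStep d Lc j) (Spure d Lc cE cVH cΛ j)) (unitM (sfStep Lc j) (smStep d Lc j) (M1 d Lc cΛ j))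
              (W2SymOfK (unitK (sfStep Lc j) (smStep d Lc j) (KInvStep (d := d) Lc j)) Lc
                (unitS (sfStep Lc j) (smStep d Lc j) (Spure d Lc cE cVH cΛ j)) (unitM (sfStep Lc j) (smStep d Lc j) (M1 d Lc cΛ j)) 0
                (unitM₂ (sfStep Lc j) (smStep d Lc j) (M2Of d Lc mixFF j))) κ u κ' u')
          + cB • mfNeg (vh₂S κ u κ' u')) κ κ' (Sum.inl α) (Sum.inl β) = 0) ↔
      ∀ (κ : Fin (d + 1)) (u : Fin (d + 1) → ℤ) (κ' α β : Fin (d + 1)),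
        (∑' u', ∑' x, ∑' z,
          ((cE₂ * (Lc : ℝ) ^ (2 * (d + 1))) •
              mmRead Lc (K3OfK (unitK (sfStep Lc j) (smStep d Lc j) (KInvStep (d := d) Lc j)) Lc
                (unitS (sfStep Lc j) (smStep d Lc j) (Spure d Lc cE cVH cΛ j)) (unitM (sfStep Lc j) (smStep d Lc j) (M1 d Lc cΛ j))
                (W2SymOfK (unitK (sfStep Lc j) (smStep d Lc j) (KInvStep (d := d) Lc j)) Lc
                  (unitS (sfStep Lc j) (smStep d Lc j) (Spure d Lc cE cVH cΛ j)) (unitM (sfStep Lc j) (smStep d Lc j) (M1 d Lc cΛ j)) 0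
                  (unitM₂ (sfStep Lc j) (smStep d Lc j) (M2Of d Lc mixFF j))) κ u κ' u')
            + cB • mfNeg (vh₂S κ u κ' u')) x z (Sum.inl α) (Sum.inl β)) = 0 :=
  zmode_ff_eq_zero_iff_pointwise_of_ff hN fun α β => bracket_ff_translate hLc cE cVH cΛ hmixt hBff cE₂ cB j α β

/-! ## §4 Instances: an1's tables at any roots; the row's literal base-root text -/

end Generic

/-- [folklore] **THE BRACKET BRIDGE AT an1's TABLES, ANY ROOTS** (`vh₂S := vh₂SAt ρ Lc`, `mixFF := mixFFAt ρ′ Lc`): no binder left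
(`rfl`, an1's `mixFFAt_translate`). -/
theorem zmode_ff_bracket_iff_pointwise_an1 {N : ℕ} (hN : N ≠ 0) (hLc : 1 ≤ Lc) (ρ ρ' : Fin (d + 1) → ℤ) (cE cVH cΛ cE₂ cB : ℝ)
    (j : ℕ) :
    (∀ (κ κ' α β : Fin (d + 1)),
        zmode N (fun κ u κ' u' => (cE₂ * (Lc : ℝ) ^ (2 * (d + 1))) •
            mmRead Lc (K3OfK (unitK (sfStep Lc j) (smStep d Lc j) (KInvStep (d := d) Lc j)) Lc
              (unitS (sfStep Lc j) (smStep d Lc j) (Spure d Lc cE cVH cΛ j)) (unitM (sfStep Lc j) (smStep d Lc j) (M1 d Lc cΛ j))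
              (W2SymOfK (unitK (sfStep Lc j) (smStep d Lc j) (KInvStep (d := d) Lc j)) Lc
                (unitS (sfStep Lc j) (smStep d Lc j) (Spure d Lc cE cVH cΛ j)) (unitM (sfStep Lc j) (smStep d Lc j) (M1 d Lc cΛ j)) 0
                (unitM₂ (sfStep Lc j) (smStep d Lc j) (M2Of d Lc (mixFFAt ρ' Lc) j))) κ u κ' u')
          + cB • mfNeg (vh₂SAt ρ Lc κ u κ' u')) κ κ' (Sum.inl α) (Sum.inl β) = 0) ↔
      ∀ (κ : Fin (d + 1)) (u : Fin (d + 1) → ℤ) (κ' α β : Fin (d + 1)),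
        (∑' u', ∑' x, ∑' z,
          ((cE₂ * (Lc : ℝ) ^ (2 * (d + 1))) •
              mmRead Lc (K3OfK (unitK (sfStep Lc j) (smStep d Lc j) (KInvStep (d := d) Lc j)) Lc
                (unitS (sfStep Lc j) (smStep d Lc j) (Spure d Lc cE cVH cΛ j)) (unitM (sfStep Lc j) (smStep d Lc j) (M1 d Lc cΛ j))
                (W2SymOfK (unitK (sfStep Lc j) (smStep d Lc j) (KInvStep (d := d) Lc j)) Lc
                  (unitS (sfStep Lc j) (smStep d Lc j) (Spure d Lc cE cVH cΛ j)) (unitM (sfStep Lc j) (smStep d Lc j) (M1 d Lc cΛ j)) 0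
                  (unitM₂ (sfStep Lc j) (smStep d Lc j) (M2Of d Lc (mixFFAt ρ' Lc) j))) κ u κ' u')
            + cB • mfNeg (vh₂SAt ρ Lc κ u κ' u')) x z (Sum.inl α) (Sum.inl β)) = 0 :=
  zmode_ff_bracket_iff_pointwise hLc cE cVH cΛ (mixFFAt_translate ρ' Lc) (vh₂SAt_inl_inl' ρ Lc) hN cE₂ cB j

/-- [folklore] **THE BRACKET BRIDGE IN THE ROW's LITERAL BASE-ROOT TEXT** (`vh₂S d Lc`; generic `mixFF` under its one covariance binder
`hmixt`, discharged at an1's table by `mixFFAt_translate` at any root). -/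
theorem zmode_ff_bracket_iff_pointwise_base {N : ℕ} (hN : N ≠ 0) (hLc : 1 ≤ Lc) (cE cVH cΛ cE₂ cB : ℝ) {mixFF : Tab d}
    (hmixt : ∀ (κ : Fin (d + 1)) (u : Fin (d + 1) → ℤ) (ρ : Fin (d + 1)) (w t : Fin (d + 1) → ℤ),
      mixFF κ (u + (Lc : ℤ) • t) ρ (w + t) = shiftK (-((Lc : ℤ) • t)) (mixFF κ u ρ w)) (j : ℕ) :
    (∀ (κ κ' α β : Fin (d + 1)),
        zmode N (fun κ u κ' u' => (cE₂ * (Lc : ℝ) ^ (2 * (d + 1))) •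
            mmRead Lc (K3OfK (unitK (sfStep Lc j) (smStep d Lc j) (KInvStep (d := d) Lc j)) Lc
              (unitS (sfStep Lc j) (smStep d Lc j) (Spure d Lc cE cVH cΛ j)) (unitM (sfStep Lc j) (smStep d Lc j) (M1 d Lc cΛ j))
              (W2SymOfK (unitK (sfStep Lc j) (smStep d Lc j) (KInvStep (d := d) Lc j)) Lc
                (unitS (sfStep Lc j) (smStep d Lc j) (Spure d Lc cE cVH cΛ j)) (unitM (sfStep Lc j) (smStep d Lc j) (M1 d Lc cΛ j)) 0
                (unitM₂ (sfStep Lc j) (smStep d Lc j) (M2Of d Lc mixFF j))) κ u κ' u')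
          + cB • mfNeg (vh₂S d Lc κ u κ' u')) κ κ' (Sum.inl α) (Sum.inl β) = 0) ↔
      ∀ (κ : Fin (d + 1)) (u : Fin (d + 1) → ℤ) (κ' α β : Fin (d + 1)),
        (∑' u', ∑' x, ∑' z,
          ((cE₂ * (Lc : ℝ) ^ (2 * (d + 1))) •
              mmRead Lc (K3OfK (unitK (sfStep Lc j) (smStep d Lc j) (KInvStep (d := d) Lc j)) Lc
                (unitS (sfStep Lc j) (smStep d Lc j) (Spure d Lc cE cVH cΛ j)) (unitM (sfStep Lc j) (smStep d Lc j) (M1 d Lc cΛ j))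
                (W2SymOfK (unitK (sfStep Lc j) (smStep d Lc j) (KInvStep (d := d) Lc j)) Lc
                  (unitS (sfStep Lc j) (smStep d Lc j) (Spure d Lc cE cVH cΛ j)) (unitM (sfStep Lc j) (smStep d Lc j) (M1 d Lc cΛ j)) 0
                  (unitM₂ (sfStep Lc j) (smStep d Lc j) (M2Of d Lc mixFF j))) κ u κ' u')
            + cB • mfNeg (vh₂S d Lc κ u κ' u')) x z (Sum.inl α) (Sum.inl β)) = 0 :=
  zmode_ff_bracket_iff_pointwise hLc cE cVH cΛ hmixt (vh₂SAt_inl_inl' 0 Lc) hN cE₂ cB j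

end Summit.QuantumFields.BalabanUV.Beta.GAN24.T2OfBracketCovariance

end
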